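import Summits.QuantumAdvantage.QuantumAdvantage.Theorems.CharDialTokenDialN2
import Summits.QuantumAdvantage.QuantumAdvantage.Theorems.CharDialTokenDialN3
import Summits.QuantumAdvantage.QuantumAdvantage.Theorems.CharDialTokenDialJ
import HarnessLib

/-!
# WalkHardFJLinOdd — the token dial, part N: the FAR-READER flip engine

Cell `decomp-qadv`, lens 6, generation 19 (REV4 «FarFlipDial»).  Part J's `engineFlip` required every reacting cut (reader) to be
numbered within `w` of the swapped pair (the gap between reader and pair is frozen into the cell pattern).  Here a tuple
`far : Fin m → Fin (n+1)` of FAR readers at arbitrary distance is allowed: the unit of the count is a (cell, gap-residue) class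
(part N2's `classR`: the windows between the far readers and cut `t` carry prescribed numbers of ones mod `3`), on which the flip is a
constant per address class (part N3's `flip_iff_phiR` with the oracle `gapOf`); inside such a class the address of cut `t` is still
equidistributed (part N2's ★ `classR_le_three_classF`, from the weighted two-moduli count of part N1) PROVIDED the address row and the
gap rows are independent at level `L` (`IndepRows t far L`).  The charge shift `c ↦ c + k` moves the address and leaves the gap
residues alone, so the any-charge flip set is still covered by the flipping classes of ONE charge:
★ `engineFar`: `6·#WIN_c + #flipAny ≤ 6·2ⁿ + 16·3^m·p^{|R|}·2^{Σ_{g ∈ R}|J_g| + 2w}·2ⁿ·cos(π/(3p))^L`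
for every reader set `R ∋ cut t` containing the far readers, whose other members lie within `w` of cut `t`, outside which the strategy is
swap-stable on the swap set.  No `3^{-m}` is lost in the main term.
-/

set_option autoImplicit false

namespace Summit.QuantumAdvantage.AdviceFreeQNC0.JLinPeel.TokenDial

open Finset SegMove

variable {n : ℕ}

section FarEngine

variable {p : ℕ} [hp : Fact p.Prime] {m : ℕ}

/-! ### §16 the oracle of a unit, flipping units -/

/-- the gap-residue ORACLE of a unit: a far reader reads its prescribed residue, any other cut the pattern's window count. -/
noncomputable def gapOf (t : Fin n) (far : Fin m → Fin (n + 1)) (T : Finset (Fin n)) (ρ : Fin m → ZMod 3) :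
    Fin (n + 1) → ℕ := fun g =>
  if h : ∃ k, far k = g then (ρ h.choose).val else wseg (patt T) (min g.val t.val) (max g.val t.val)

omit hp in
/-- **(the oracle is right on its class).** -/
theorem oracle_ok (O T : Finset (Fin n)) (u : Fin n → Bool) (hu : ∀ j ∈ O, u j = patt T j) (t : Fin n)
    (far : Fin m → Fin (n + 1)) (ρ : Fin m → ZMod 3) (R : Finset (Fin (n + 1)))
    (hfar : ∀ k, ((wseg u (min (far k).val t.val) (max (far k).val t.val) : ℕ) : ZMod 3) = ρ k)
    (hnear : ∀ g ∈ R, (¬ ∃ k, far k = g) → ∀ i : Fin n, min g.val t.val ≤ i.val → i.val < max g.val t.val → i ∈ O) :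
    ∀ g ∈ R, wseg u (min g.val t.val) (max g.val t.val) % 3 = gapOf t far T ρ g % 3 := by
  intro g hg
  unfold gapOf
  by_cases h : ∃ k, far k = g
  · rw [dif_pos h]
    have hk : far h.choose = g := h.choose_spec
    have hv := hfar h.choose
    rw [hk] at hv
    rw [← hv, ZMod.val_natCast, Nat.mod_mod]
  · rw [dif_neg h, wseg_eq_patt_of_gap O T u hu t g (hnear g hg h)]

/-- the first flipping class of a unit (`2` if none of `0, 1` flips). -/
noncomputable def rflipR (D : JLinData p n) (R : Finset (Fin (n + 1))) (s t : Fin n) (far : Fin m → Fin (n + 1))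
    (T : Finset (Fin n)) (V : Fin (n + 1) → ZMod p) (ρ : Fin m → ZMod 3) : ℕ :=
  if phiR D R s t T V (gapOf t far T ρ) 0 = true then 0 else if phiR D R s t T V (gapOf t far T ρ) 1 = true then 1 else 2

/-- it is an address class. -/
theorem rflipR_lt (D : JLinData p n) (R : Finset (Fin (n + 1))) (s t : Fin n) (far : Fin m → Fin (n + 1))
    (T : Finset (Fin n)) (V : Fin (n + 1) → ZMod p) (ρ : Fin m → ZMod 3) : rflipR D R s t far T V ρ < 3 := by
  unfold rflipR; split_ifs <;> norm_num

/-- a unit FLIPS if its flip table has a flipping class. -/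
noncomputable def flipsR (D : JLinData p n) (R : Finset (Fin (n + 1))) (s t : Fin n) (far : Fin m → Fin (n + 1))
    (T : Finset (Fin n)) (V : Fin (n + 1) → ZMod p) (ρ : Fin m → ZMod 3) : Bool :=
  (phiR D R s t T V (gapOf t far T ρ) 0 || phiR D R s t T V (gapOf t far T ρ) 1) || phiR D R s t T V (gapOf t far T ρ) 2

/-- on a flipping unit the class `rflipR` flips. -/
theorem phiR_rflip (D : JLinData p n) (R : Finset (Fin (n + 1))) (s t : Fin n) (far : Fin m → Fin (n + 1))
    (T : Finset (Fin n)) (V : Fin (n + 1) → ZMod p) (ρ : Fin m → ZMod 3) (h : flipsR D R s t far T V ρ = true) :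
    phiR D R s t T V (gapOf t far T ρ) (rflipR D R s t far T V ρ) = true := by
  unfold flipsR at h
  unfold rflipR
  by_cases h0 : phiR D R s t T V (gapOf t far T ρ) 0 = true
  · rw [if_pos h0]; exact h0
  · rw [if_neg h0]
    by_cases h1 : phiR D R s t T V (gapOf t far T ρ) 1 = true
    · rw [if_pos h1]; exact h1
    · rw [if_neg h1]
      rw [Bool.or_eq_true, Bool.or_eq_true] at h
      rcases h with (h | h) | h
      · exact absurd h h0
      · exact absurd h h1
      · exact h

/-- a unit with some flipping class flips. -/
theorem flipsR_of_phiR (D : JLinData p n) (R : Finset (Fin (n + 1))) (s t : Fin n) (far : Fin m → Fin (n + 1))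
    (T : Finset (Fin n)) (V : Fin (n + 1) → ZMod p) (ρ : Fin m → ZMod 3) (r : ℕ) (hr : r < 3)
    (h : phiR D R s t T V (gapOf t far T ρ) r = true) : flipsR D R s t far T V ρ = true := by
  unfold flipsR
  rw [Bool.or_eq_true, Bool.or_eq_true]
  interval_cases r
  · exact Or.inl (Or.inl h)
  · exact Or.inl (Or.inr h)
  · exact Or.inr h

/-! ### §16' units: cover, class parts, disjointness -/

/-- the UNITS: a cell index and a gap-residue vector. -/
def idxR (R : Finset (Fin (n + 1))) (O : Finset (Fin n)) (s t : Fin n) (m : ℕ) :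
    Finset ((Finset (Fin n) × (Fin (n + 1) → ZMod p)) × (Fin m → ZMod 3)) :=
  idxF R O s t ×ˢ (univ : Finset (Fin m → ZMod 3))

/-- the number of units: `≤ 2^{|O|}·p^{|R|}·3^m`. -/
theorem card_idxR_le (R : Finset (Fin (n + 1))) (O : Finset (Fin n)) (s t : Fin n) (m : ℕ) :
    (idxR (p := p) R O s t m).card ≤ 2 ^ O.card * p ^ R.card * 3 ^ m := by
  classical
  unfold idxR
  rw [card_product, card_univ, Fintype.card_fun, ZMod.card, Fintype.card_fin]
  exact Nat.mul_le_mul_right _ (card_idxF_le R O s t)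

/-- **(flipAny ⊆ ⋃ flipping units).** -/
theorem flipAny_subset_far (D : JLinData p n) (R : Finset (Fin (n + 1))) (O : Finset (Fin n)) (s t : Fin n)
    (far : Fin m → Fin (n + 1)) (hst : t.val = s.val + 1) (hsO : s ∈ O) (htO : t ∈ O) (htR : cut t ∈ R)
    (hS : ∀ g, g ∉ R → ∀ u : Fin n → Bool, u s ≠ u t → D.strat g (segCompl u s.val (s.val + 2)) = D.strat g u)
    (hJO : ∀ g ∈ R, D.J g ⊆ O)
    (hnear : ∀ g ∈ R, (¬ ∃ k, far k = g) → ∀ i : Fin n, min g.val t.val ≤ i.val → i.val < max g.val t.val → i ∈ O) :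
    flipAny D.strat s t ⊆ ((idxR R O s t m).filter fun X => flipsR D R s t far X.1.1 X.1.2 X.2 = true).biUnion fun X =>
      classR O (patt X.1.1) (formsOf D R) X.1.2 t far X.2 := by
  classical
  intro u hu
  rw [mem_flipAny] at hu
  obtain ⟨hne, hflip⟩ := hu
  rw [mem_biUnion]
  have hpat := patt_filter O u
  set ρ : Fin m → ZMod 3 := fun k => ((wseg u (min (far k).val t.val) (max (far k).val t.val) : ℕ) : ZMod 3) with hρ
  have hcell : u ∈ cellM O (patt (O.filter fun j => u j = true)) (formsOf D R)
      (fun g => if g ∈ R then form (D.a g) u else 0) := by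
    rw [mem_cellM]
    refine ⟨hpat, fun g => ?_⟩
    unfold formsOf
    by_cases hg : g ∈ R
    · rw [if_pos hg, if_pos hg]
    · rw [if_neg hg, if_neg hg, form_zero]
  have hclass : u ∈ classR O (patt (O.filter fun j => u j = true)) (formsOf D R)
      (fun g => if g ∈ R then form (D.a g) u else 0) t far ρ := by
    unfold classR
    rw [mem_filter]
    exact ⟨hcell, fun k => rfl⟩
  have hor := oracle_ok O (O.filter fun j => u j = true) u hpat t far ρ R (fun k => rfl) hnear
  refine ⟨((O.filter fun j => u j = true, fun g => if g ∈ R then form (D.a g) u else 0), ρ), ?_, hclass⟩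
  rw [mem_filter]
  unfold idxR
  rw [mem_product, mem_idxF]
  refine ⟨⟨⟨⟨filter_subset _ _, ?_⟩, ?_⟩, mem_univ _⟩, ?_⟩
  · rw [Fintype.mem_piFinset]
    intro g
    by_cases hg : g ∈ R
    · simp only [if_pos hg]; exact mem_univ _
    · simp only [if_neg hg]; exact mem_singleton_self _
  · rw [← hpat s hsO, ← hpat t htO]; exact hne
  · have key : ∀ c : ℕ, ringWinU c D.strat (segCompl u s.val (s.val + 2)) ≠ ringWinU c D.strat u →
        flipsR D R s t far (O.filter fun j => u j = true) (fun g => if g ∈ R then form (D.a g) u else 0) ρ = true :=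
      fun c hc => flipsR_of_phiR D R s t far _ _ ρ (addr c u t.val) (addr_lt_three c u t.val)
        ((flip_iff_phiR c D R O s t hst hsO htO htR hS hJO _ _ (gapOf t far _ ρ) u hcell hne hor).1 hc)
    rcases hflip with h | h | h
    · exact key 0 h
    · exact key 1 h
    · exact key 2 h

/-- **(the flipping class of a flipping unit lies in `flipE_c`).** -/
theorem classPart_subset_flipE_far (c : ℕ) (D : JLinData p n) (R : Finset (Fin (n + 1))) (O : Finset (Fin n))
    (s t : Fin n) (far : Fin m → Fin (n + 1)) (hst : t.val = s.val + 1) (hsO : s ∈ O) (htO : t ∈ O) (htR : cut t ∈ R)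
    (hS : ∀ g, g ∉ R → ∀ u : Fin n → Bool, u s ≠ u t → D.strat g (segCompl u s.val (s.val + 2)) = D.strat g u)
    (hJO : ∀ g ∈ R, D.J g ⊆ O)
    (hnear : ∀ g ∈ R, (¬ ∃ k, far k = g) → ∀ i : Fin n, min g.val t.val ≤ i.val → i.val < max g.val t.val → i ∈ O)
    (X : (Finset (Fin n) × (Fin (n + 1) → ZMod p)) × (Fin m → ZMod 3)) (hX : patt X.1.1 s ≠ patt X.1.1 t)
    (hfl : flipsR D R s t far X.1.1 X.1.2 X.2 = true) :
    classF c O (patt X.1.1) (formsOf D R) X.1.2 t far X.2 (rflipR D R s t far X.1.1 X.1.2 X.2) ⊆ flipE c D.strat s t := by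
  intro u hu
  unfold classF at hu
  rw [mem_filter] at hu
  obtain ⟨hcell, hr, hρ⟩ := hu
  have hpat := ((mem_cellM O (patt X.1.1) (formsOf D R) X.1.2 u).1 hcell).1
  have hne : u s ≠ u t := by rw [hpat s hsO, hpat t htO]; exact hX
  have hor := oracle_ok O X.1.1 u hpat t far X.2 R hρ hnear
  rw [mem_flipE]
  refine ⟨hne, ?_⟩
  rw [flip_iff_phiR c D R O s t hst hsO htO htR hS hJO _ _ (gapOf t far X.1.1 X.2) u hcell hne hor, hr]
  exact phiR_rflip D R s t far X.1.1 X.1.2 X.2 hfl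

omit hp in
/-- gap-residue classes of one cell with different residue vectors are disjoint. -/
theorem classR_disjoint_rho (O : Finset (Fin n)) (β : Fin n → Bool) (A : Fin (n + 1) → Fin n → ZMod p)
    (V : Fin (n + 1) → ZMod p) (t : Fin n) (far : Fin m → Fin (n + 1)) {ρ ρ' : Fin m → ZMod 3} (hne : ρ ≠ ρ') :
    Disjoint (classR O β A V t far ρ) (classR O β A V t far ρ') := by
  rw [disjoint_left]
  intro u hu hu'
  unfold classR at hu hu'
  rw [mem_filter] at hu hu'
  apply hne
  funext k
  rw [← hu.2 k, ← hu'.2 k]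

omit hp in
/-- the units' classes are pairwise disjoint. -/
theorem classR_disjoint_units (O : Finset (Fin n)) (A : Fin (n + 1) → Fin n → ZMod p) (t : Fin n)
    (far : Fin m → Fin (n + 1)) {X X' : (Finset (Fin n) × (Fin (n + 1) → ZMod p)) × (Fin m → ZMod 3)}
    (h1 : X.1.1 ⊆ O) (h2 : X'.1.1 ⊆ O) (hne : X ≠ X') :
    Disjoint (classR O (patt X.1.1) A X.1.2 t far X.2) (classR O (patt X'.1.1) A X'.1.2 t far X'.2) := by
  classical
  by_cases hTV : X.1 = X'.1
  · have hρ : X.2 ≠ X'.2 := fun h => hne (Prod.ext hTV h)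
    rw [show X'.1.1 = X.1.1 from (congrArg Prod.fst hTV).symm, show X'.1.2 = X.1.2 from (congrArg Prod.snd hTV).symm]
    exact classR_disjoint_rho O (patt X.1.1) A X.1.2 t far hρ
  · have hd := cellM_disjoint O A h1 h2 (V := X.1.2) (V' := X'.1.2) (by
      intro h; apply hTV; exact Prod.ext (congrArg Prod.fst h) (congrArg Prod.snd h))
    unfold classR
    exact disjoint_filter_filter hd

/-- **(counting the flipping classes)** `Σ_{flipping units} #(class-rflipR part) ≤ |flipE_c|`. -/
theorem sum_classPart_le_flipE_far (c : ℕ) (D : JLinData p n) (R : Finset (Fin (n + 1))) (O : Finset (Fin n))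
    (s t : Fin n) (far : Fin m → Fin (n + 1)) (hst : t.val = s.val + 1) (hsO : s ∈ O) (htO : t ∈ O) (htR : cut t ∈ R)
    (hS : ∀ g, g ∉ R → ∀ u : Fin n → Bool, u s ≠ u t → D.strat g (segCompl u s.val (s.val + 2)) = D.strat g u)
    (hJO : ∀ g ∈ R, D.J g ⊆ O)
    (hnear : ∀ g ∈ R, (¬ ∃ k, far k = g) → ∀ i : Fin n, min g.val t.val ≤ i.val → i.val < max g.val t.val → i ∈ O) :
    ∑ X ∈ (idxR R O s t m).filter (fun X => flipsR D R s t far X.1.1 X.1.2 X.2 = true),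
        (classF c O (patt X.1.1) (formsOf D R) X.1.2 t far X.2 (rflipR D R s t far X.1.1 X.1.2 X.2)).card
      ≤ (flipE c D.strat s t).card := by
  classical
  rw [← card_biUnion]
  · refine card_le_card (biUnion_subset.2 fun X hX => ?_)
    have hmem := (mem_filter.1 hX).1
    unfold idxR at hmem
    rw [mem_product] at hmem
    exact classPart_subset_flipE_far c D R O s t far hst hsO htO htR hS hJO hnear X
      ((mem_idxF R O s t X.1).1 hmem.1).2 (mem_filter.1 hX).2
  · intro X hX X' hX' hne
    have hm1 := (mem_filter.1 hX).1
    have hm2 := (mem_filter.1 hX').1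
    unfold idxR at hm1 hm2
    rw [mem_product] at hm1 hm2
    have h1 := ((mem_idxF R O s t X.1).1 hm1.1).1.1
    have h2 := ((mem_idxF R O s t X'.1).1 hm2.1).1.1
    have hd := classR_disjoint_units O (formsOf D R) t far h1 h2 hne
    unfold classR at hd
    rw [disjoint_left] at hd
    change Disjoint _ _
    refine disjoint_left.2 fun u hu hu' => ?_
    unfold classF at hu hu'
    rw [mem_filter] at hu hu'
    exact hd (mem_filter.2 ⟨hu.1, hu.2.2⟩) (mem_filter.2 ⟨hu'.1, hu'.2.2⟩)

/-! ### §16'' the far engine -/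

/-- ★ **THE FAR-READER FLIP ENGINE INEQUALITY.** for a junta ⊕ `𝔽_p`-form presentation (`3 ∤ p`), an adjacent pair `(s, t = s+1)`,
a reader set `R ∋ cut t`, a tuple `far` of far readers in `R`, every other reader within `w` of cut `t`, the strategy swap-stable outside
`R` on the swap set, and the address/gap rows independent at level `L`:
`6·#WIN_c + #flipAny ≤ 6·2ⁿ + 16·3^m·p^{|R|}·2^{Σ_{g ∈ R}|J_g| + 2w}·2ⁿ·cos(π/(3p))^L`. -/
theorem engineFar (hp3 : p ≠ 3) (c : ℕ) (D : JLinData p n) (s t : Fin n) (hst : t.val = s.val + 1)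
    (R : Finset (Fin (n + 1))) (htR : cut t ∈ R) (far : Fin m → Fin (n + 1)) (w L : ℕ)
    (hnear : ∀ g ∈ R, (¬ ∃ k, far k = g) → t.val ≤ g.val + w ∧ g.val ≤ t.val + w)
    (hI : IndepRows t far L)
    (hS : ∀ g, g ∉ R → ∀ u : Fin n → Bool, u s ≠ u t → D.strat g (segCompl u s.val (s.val + 2)) = D.strat g u) :
    6 * ((univ.filter fun u : Fin n → Bool => ringWinU c D.strat u = true).card : ℝ)
      + ((flipAny D.strat s t).card : ℝ)
      ≤ 6 * (2 : ℝ) ^ n + 16 * (3 : ℝ) ^ m * (p : ℝ) ^ R.card *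
          (2 : ℝ) ^ ((∑ g ∈ R, (D.J g).card) + 2 * w) * (2 : ℝ) ^ n * Real.cos (Real.pi / (3 * p)) ^ L := by
  classical
  set O : Finset (Fin n) := insert s (insert t (R.biUnion D.J ∪ wind t w)) with hO
  have hJO : ∀ g ∈ R, D.J g ⊆ O := fun g hg i hi => by
    rw [hO]; exact mem_insert_of_mem (mem_insert_of_mem (mem_union_left _ (mem_biUnion.2 ⟨g, hg, hi⟩)))
  have hsO : s ∈ O := by rw [hO]; exact mem_insert_self _ _
  have htO : t ∈ O := by rw [hO]; exact mem_insert_of_mem (mem_insert_self _ _)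
  have hgap : ∀ g ∈ R, (¬ ∃ k, far k = g) → ∀ i : Fin n, min g.val t.val ≤ i.val → i.val < max g.val t.val → i ∈ O := by
    intro g hg hfar i h1 h2
    have hn := hnear g hg hfar
    rw [min_le_iff] at h1
    rw [lt_max_iff] at h2
    rw [hO]
    refine mem_insert_of_mem (mem_insert_of_mem (mem_union_right _ ?_))
    unfold wind
    rw [mem_filter]
    exact ⟨mem_univ _, by omega, by omega⟩
  have hOcard : O.card ≤ (∑ g ∈ R, (D.J g).card) + 2 * w + 2 := by
    rw [hO]
    refine (card_insert_le _ _).trans ?_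
    have h1 := card_insert_le t (R.biUnion D.J ∪ wind t w)
    have h2 : (R.biUnion D.J).card ≤ ∑ g ∈ R, (D.J g).card := card_biUnion_le
    have h3 := card_union_le (R.biUnion D.J) (wind t w)
    have h4 := card_wind_le t w
    omega
  set err : ℝ := 4 * (2 : ℝ) ^ n * Real.cos (Real.pi / (3 * p)) ^ L with herr
  -- (1) the pairing inequality
  have hpair := flip_pairing c D.strat s t hst
  -- (2) flipAny is covered by the flipping units
  have hRc : ((flipAny D.strat s t).card : ℝ)
      ≤ ∑ X ∈ (idxR R O s t m).filter (fun X => flipsR D R s t far X.1.1 X.1.2 X.2 = true),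
          ((classR O (patt X.1.1) (formsOf D R) X.1.2 t far X.2).card : ℝ) := by
    have h := (card_le_card (flipAny_subset_far D R O s t far hst hsO htO htR hS hJO hgap)).trans card_biUnion_le
    exact_mod_cast h
  -- (3) the flipping classes fit into flipE
  have hE := sum_classPart_le_flipE_far c D R O s t far hst hsO htO htR hS hJO hgap
  -- (4) per flipping unit: a third, up to err
  have hunit : ∀ X ∈ (idxR R O s t m).filter (fun X => flipsR D R s t far X.1.1 X.1.2 X.2 = true),
      ((classR O (patt X.1.1) (formsOf D R) X.1.2 t far X.2).card : ℝ) ≤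
        3 * (((classF c O (patt X.1.1) (formsOf D R) X.1.2 t far X.2 (rflipR D R s t far X.1.1 X.1.2 X.2)).card : ℕ) : ℝ)
          + err := by
    intro X _
    exact classR_le_three_classF hp3 c O (patt X.1.1) (formsOf D R) X.1.2 t far X.2 _
      (rflipR_lt D R s t far X.1.1 X.1.2 X.2) L hI
  have hsum := sum_le_sum hunit
  rw [sum_add_distrib, ← mul_sum, sum_const, nsmul_eq_mul] at hsum
  -- (5) sizes
  have hidx : (((idxR R O s t m).filter (fun X => flipsR D R s t far X.1.1 X.1.2 X.2 = true)).card : ℝ)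
      ≤ 4 * (2 : ℝ) ^ ((∑ g ∈ R, (D.J g).card) + 2 * w) * (p : ℝ) ^ R.card * (3 : ℝ) ^ m := by
    have h := (card_filter_le (idxR R O s t m) (fun X => flipsR D R s t far X.1.1 X.1.2 X.2 = true)).trans
      (card_idxR_le (p := p) R O s t m)
    have h2 : (2 : ℕ) ^ O.card ≤ 2 ^ ((∑ g ∈ R, (D.J g).card) + 2 * w + 2) := Nat.pow_le_pow_right (by norm_num) hOcard
    have h3 : ((idxR R O s t m).filter (fun X => flipsR D R s t far X.1.1 X.1.2 X.2 = true)).card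
        ≤ 2 ^ ((∑ g ∈ R, (D.J g).card) + 2 * w + 2) * p ^ R.card * 3 ^ m :=
      h.trans (Nat.mul_le_mul_right _ (Nat.mul_le_mul_right _ h2))
    have h4 : (((idxR R O s t m).filter (fun X => flipsR D R s t far X.1.1 X.1.2 X.2 = true)).card : ℝ)
        ≤ ((2 ^ ((∑ g ∈ R, (D.J g).card) + 2 * w + 2) * p ^ R.card * 3 ^ m : ℕ) : ℝ) := by exact_mod_cast h3
    refine h4.trans (le_of_eq ?_)
    push_cast
    ring
  have herr0 : 0 ≤ err := by
    rw [herr]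
    have hcos : 0 ≤ Real.cos (Real.pi / (3 * p)) := by
      haveI : NeZero p := ⟨hp.out.ne_zero⟩
      linarith [one_le_two_mul_cos p]
    positivity
  have hpairR : 2 * ((univ.filter fun u : Fin n → Bool => ringWinU c D.strat u = true).card : ℝ)
      + ((flipE c D.strat s t).card : ℝ) ≤ 2 * (2 : ℝ) ^ n := by exact_mod_cast hpair
  have hER : ((∑ X ∈ (idxR R O s t m).filter (fun X => flipsR D R s t far X.1.1 X.1.2 X.2 = true),
      (classF c O (patt X.1.1) (formsOf D R) X.1.2 t far X.2 (rflipR D R s t far X.1.1 X.1.2 X.2)).card : ℕ) : ℝ)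
      ≤ ((flipE c D.strat s t).card : ℝ) := by exact_mod_cast hE
  push_cast at hER hsum
  have hpp : (0 : ℝ) ≤ 4 * (2 : ℝ) ^ ((∑ g ∈ R, (D.J g).card) + 2 * w) * (p : ℝ) ^ R.card * (3 : ℝ) ^ m := by positivity
  have hmul : (((idxR R O s t m).filter (fun X => flipsR D R s t far X.1.1 X.1.2 X.2 = true)).card : ℝ) * err
      ≤ 4 * (2 : ℝ) ^ ((∑ g ∈ R, (D.J g).card) + 2 * w) * (p : ℝ) ^ R.card * (3 : ℝ) ^ m * err :=
    mul_le_mul_of_nonneg_right hidx herr0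
  rw [herr] at hmul
  nlinarith [hRc, hsum, hER, hpairR, hmul, herr0]

end FarEngine

end Summit.QuantumAdvantage.AdviceFreeQNC0.JLinPeel.TokenDial
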